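import Literature.MathematicalPhysics.QuantumFieldTheory.Balaban1983to89.Node00.OpsYDeltaA
import Literature.MathematicalPhysics.QuantumFieldTheory.Balaban1983to89.B13PolynomialRangeLetters

/-!
# `Balaban1983to89.B13TransportedLiftLetters` — T. Bałaban, *Propagators for lattice gauge theories in a background field*, Commun.
# Math. Phys. **99** (1985) 389–434 [Balaban1985BackgroundPropagators], (3.3) p. 390, (3.4)–(3.5) p. 391, (3.8)–(3.9) p. 392,
# (3.12)–(3.14) p. 393 (the LOCAL covariant letters `D_U`, `D*_U`, the plaquette derivative, `Q(U)`, `Q*(U)`, `Q′(U)`: every one a flat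
# kernel whose far argument is parallel-transported, `Σ_x M(y,x)·R(U(Γ_{y,x}))λ(x)`, `R(V)X = VXV⁻¹`), p. 390 («U = U′U₀, U′ = exp iηA»),
# Thm 3.4 p. 400 («extend to configurations U′U … as analytic functions of A») and (3.50) p. 400 (`Δ_{U′U}λ(x) = η⁻²(2dλ(x) −
# Σ_b exp(iη ad A(b))R(U_b)λ(b₊))` — an «analytic function of A(b)»), Thm 3.10 (3.108) p. 416 (the class `|G(x,x′)| ≤ Be^{−δd(x,x′)}`);
# *Renormalization group approach to lattice gauge field theories. II*, Commun. Math. Phys. **116** (1988) 1–22 [Balaban1988RG2Cluster],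
# (2.5) p. 12 and p. 15 («The general case is handled by a perturbative argument … analytic functions»): THE TRANSPORTED LIFT — NODE 00's
# ONE operator constructor `Node00.trLiftY M T` behind ALL the local letters of `Node00/OpsYDeltaA` (`gradY = D_U`, `divY = D*_U`, `curlY`,
# `coCurlY`, `QY`, `QsY`, `QpY`, `QpsY`) — READ IN THE ENTRY-LETTER CURRENCY OF THE N10 JUNCTION: along a u-DEPENDENT unit-valued
# transporter family on a complex chart ball, its coordinates are holomorphic, bounded, and of the kernel's range, hence `RawEntryLetters`.

statement-level complex analysis ([folklore]: products of holomorphic bounded Banach-algebra-valued maps composed with a continuous linear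
functional; the Banach-algebra exponential) over NODE 00's `rfl`-level operator algebra, packaged in the tree's letter currency
`B13EntrywiseWalks.RawEntryLetters` through the landed family lemma `B13AccretiveOfRealCoercive.rawEntryLetters_of_range_family` (pub-ymgap
dag-n10-c g12, module 56A) and the letter atoms ∕ word calculus of `B13PolynomialRangeLetters` (dag-n10-w4, item (D)); kernel-checked; THEOREMS
ONLY (no `def`, no `structure`, no instance, no notation); nothing here is a claim about the Yang–Mills mass gap; NOTHING of Bałaban's is
constructed or asserted; NODE 00's `trLiftY`, `R` are CONSUMED BY NAME, nothing of `Node00/OpsY*` is modified; no node is discharged;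
count-neutral.

WHY THIS FILE (cell `pub-ymgap`, HUMAN RULING D-0062 ∕ D-0149, Track A node N10 = [B13]; seat `pub-ymgap-dag-n10-c` g14, INTENT-1; the lane's
census `HOME/pub-ymgap-dag-n10-c/N10-RESIDUAL-CENSUS-v15.md` item 1, reader side, trigger (t-A0-read)).  The N10 junction of record
(`Thm/BalabanUVNodesN10B13KernelTowerWalksEntrywiseNumeralsDecorated`, module 67; inverse pieces: `…N10EntryLettersOfN06RecordFaceC`, 58B) consumes,
per located kernel family `u ↦ A(u)` on a complex chart ball `‖u‖ < R`, the TWO ENTRYWISE LETTERS `RawEntryLetters A loc R ρ B`.  For the LOCAL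
pieces the census reads «NODE 00 ∕ def-Y: the complexified formulas of the local operators on the chart at the record's members ⇒ w4's
`rawEntryLetters_of_transportWords` instances ⇒ `hEL` BY NAME».  NODE 00's local operators are not free-form formulas: EVERY ONE is
`trLiftY kernel transporters` (`Node00/OpsYDeltaA` §3: `gradY U = trLiftY (gradK i) (gradT i U)`, `divY`, `curlY`, `coCurlY = trLiftY (curlK i)ᵀ (…)⁻¹`,
`QY`, `QsY`, `QpY`, `QpsY`), with `(trLiftY M T Λ)(y) = Σ_x M(y,x) • R(T(y,x)) Λ(x)` and `R(V)X = VXV⁻¹` (`B9Eq39Adjoint.R`).  What the census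
asks of NODE 00 is therefore ONE thing — the complex chart `u ↦ U(u)` of a member's configurations (class A0; not in the tree) — and what it
asks of the letter side is THIS FILE: the reading of `trLiftY` along ANY u-dependent unit-valued transporter family.  The day the A0 chart is
pinned, `hEL` ∕ `hAL` for each def-Y local letter along it is `rawEntryLetters_trLift` (§3) + the chart's two letter bounds — or
`rawEntryLetters_trLift_pencil` ∕ `rawEntryLetters_trLift_word` (§4) verbatim if the chart is the group pencil `U(u)(b) = exp(L_b u)·U₀(b)`
read on one-bond ∕ contour-word transporters.

WHAT THIS FILE PROVES (all `theorem`s; `𝔸` a normed `ℂ`-algebra — NODE 00's letter type —, complete where the exponential enters; `E` a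
complex normed space — the chart).
* §1 THE ENTRY FORMULA OF A TRANSPORTED LIFT (pure algebra over `Node00.trLiftY_apply`): `trLiftY_single` (`(M♯_T (δ_x ⊗ e))(y) = M(y,x) •
  R(T(y,x)) e`), `coord_trLiftY_single` (through a coordinate `φ : 𝔸 →L[ℂ] ℂ`: `φ((M♯_T (δ_x ⊗ e))(y)) = M(y,x)·φ(R(T(y,x)) e)` — for
  `𝔸 = M_N(ℂ)`, `φ` = an entry and `e` = a matrix unit this IS the matrix entry of the operator in the basis site ⊗ matrix unit).
* §2 ALONG A u-DEPENDENT TRANSPORTER FAMILY `T : E → Y → X → 𝔸ˣ` with `u ↦ T(u)(y,x)` and `u ↦ T(u)(y,x)⁻¹` holomorphic on the ball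
  `‖u‖ < R` and bounded there by `Kf`, `Kb`: `differentiableOn_coord_trLift` (each coordinate `u ↦ M(y,x)·φ_k(R(T(u)(y,x)) e_l)` is
  holomorphic on the ball), `norm_coord_trLift_le` (`≤ |M(y,x)|·‖φ_k‖·(Kf·‖e_l‖·Kb)`), `coord_trLift_eq_zero_of_kernel` (it vanishes where
  the kernel does: the RANGE of the letter is the flat kernel's), `coord_trLift_eq_coord_trLiftY` (it IS `φ_k` of `trLiftY M (T u) (δ_x ⊗ e_l)`
  at `y`, §1).
* §3 ★ THE PACKAGING (square case `X = Y`, index `X × κ`, locations `loc (x,k) := ℓ x`): `rawEntryLetters_trLift` — kernel range `r₀`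
  w.r.t. `ℓ` (`M(y,x) ≠ 0 ⇒ d₁(ℓ y, ℓ x) ≤ r₀`), a uniform majorant `a` of the §2 bounds, `ρ ≥ 0`
  ⟹ `RawEntryLetters (u ↦ ((y,k),(x,l)) ↦ M(y,x)·φ_k(R(T(u)(y,x)) e_l)) loc R ρ (a·e^{ρ r₀})` (56A `rawEntryLetters_of_range_family` BY NAME).
* §4 THE DATUM SUPPLIED BY CHART LETTERS.  (a) `units_inv_eq_of_eq_exp_mul` (a unit `V` with `V = exp(a)·U₀`, `U₀` a unit, has
  `V⁻¹ = U₀⁻¹·exp(−a)` — the holomorphic stand-in for `U*` off the real configurations, [B9] (3.5) and Thm 3.4); (b) the GROUP PENCIL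
  ∕ one-letter transporters `T(u)(y,x) = exp(L_{yx} u)·U₀(y,x)` (`L_{yx} : E →L[ℂ] 𝔸`, `U₀(y,x) ∈ 𝔸ˣ`; hypothesis `hT` on the VALUES only —
  discharged by `IsUnit.unit_spec` for `T := (isUnit_exp _).unit·U₀`, `exists_pencil`): `differentiableOn_pencil`, `differentiableOn_pencil_inv`,
  `norm_pencil_le`, `norm_pencil_inv_le` (`Kf = Kb = K₀e^{ΛR}` once `‖L_{yx}‖ ≤ Λ`, `‖U₀(y,x)^{±1}‖ ≤ K₀`; w4's `B13PolynomialRangeLetters` §2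
  atoms BY NAME), ★ `rawEntryLetters_trLift_pencil`, `exists_pencil` (such a `T` EXISTS for every `L`, `U₀`: the binder `hT` is inhabited);
  (c) CONTOUR WORDS (multi-bond transporters, the shape of `Node00/OpsYTransport`'s taxicab transporters and of `curlT`): `T(u)(y,x) =
  Π_{b ∈ w(y,x)} g_b(u)` for unit-valued letters `g_b` with `g_b`, `g_b⁻¹` holomorphic and bounded by `K ≥ 1` on the ball, words of length `≤ n`:
  `val_wordChart`, `val_inv_wordChart` (the inverse is the reversed word of inverse letters), `differentiableOn_word`, `differentiableOn_word_inv`,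
  `norm_word_le`, `norm_word_inv_le` (`Kf = Kb = Kⁿ`; w4 §1 word calculus BY NAME; private plumbing `listProd_map_const_le`),
  ★ `rawEntryLetters_trLift_word`.
* §5 THE REAL POINT `u = 0` of the pencil: `pencil_zero` (`T(0)(y,x) = U₀(y,x)`), `coord_trLift_pencil_zero` (at `u = 0` the family is the
  coordinate of NODE 00's letter AT THE BACKGROUND `U₀`: `M(y,x)·φ_k(R(T(0)(y,x)) e_l) = φ_k((trLiftY M U₀ (δ_x ⊗ e_l))(y))` — the algebraic
  half of the junction's real-point identity; identifying `U₀` with the record's background is the consumer's reading).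
HONEST FRAMING: [folklore] complex analysis in the tree's letter currency over NODE 00's constructor; which kernels `M`, transporters, chart
`L`, background `U₀`, coordinates `φ`, probes `e`, locations `ℓ` and range `r₀` the operators OF RECORD have is NODE 00's ∕ def-Y's ∕ def-T's
formula of record, and the complex chart of a member's configurations (A0) is NOT constructed here; N10 NOT discharged; K1⁷ NOT closed; counts
unmoved (typed 28∕28 · discharged 5∕27); no `sorry`, no new named fact; standard axioms; one finite 𝕋⁴ programme at fixed ε, Bałaban AS
PRINTED; the YM mass gap (Clay) is NOT proved by any of this — R4 closes the conditional finite-𝕋⁴ rung `BalabanLadder.UV` only; nothing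
continuum ∕ ℝ⁴ ∕ OS.

References: T. Bałaban, CMP 99 (1985) 389–434 [Balaban1985BackgroundPropagators] (3.3) p.390, (3.4)–(3.5) p.391, (3.8)–(3.9) p.392,
(3.12)–(3.14) p.393, (3.21) p.394, Thm 3.4 and (3.50) p.400, Thm 3.10 (3.107)–(3.108) pp.415–416; CMP 116 (1988) 1–22 [Balaban1988RG2Cluster]
(2.5) p.12, p.15; T. Bałaban, *Averaging operations for lattice gauge theories*, CMP 98 (1985) 17–51 [Balaban1985Averaging] (52)–(55) pp.27–28
(parallel transport along contours).
-/

noncomputable section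

namespace Literature.MathematicalPhysics.QuantumFieldTheory.Balaban1983to89.B13TransportedLiftLetters

open Metric Set
open scoped Matrix
open NormedSpace (exp)
open Literature.MathematicalPhysics.QuantumFieldTheory.Balaban1983to89
open Literature.MathematicalPhysics.QuantumFieldTheory.Balaban1983to89.B9Eq39Adjoint (R R_def R_zero)
open Literature.MathematicalPhysics.QuantumFieldTheory.Balaban1983to89.Node00 (trLiftY trLiftY_apply)
open Literature.MathematicalPhysics.QuantumFieldTheory.Balaban1983to89.B9Thm37GlueTorus (tdist1)
open Literature.MathematicalPhysics.QuantumFieldTheory.Balaban1983to89.B5TorusCover (UT)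
open Literature.MathematicalPhysics.QuantumFieldTheory.Balaban1983to89.B13EntrywiseWalks (RawEntryLetters)
open Literature.MathematicalPhysics.QuantumFieldTheory.Balaban1983to89.B13AccretiveOfRealCoercive (rawEntryLetters_of_range_family)
open Literature.MathematicalPhysics.QuantumFieldTheory.Balaban1983to89.B13PolynomialRangeLetters
  (differentiable_exp_clm_mul_const norm_exp_clm_mul_const_le differentiable_const_mul_exp_neg_clm norm_const_mul_exp_neg_clm_le
    differentiableOn_listProd_map norm_listProd_map_le)

variable {𝔸 : Type} [NormedRing 𝔸] [NormedAlgebra ℂ 𝔸]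
variable {X Y : Type}
variable {E : Type*} [NormedAddCommGroup E] [NormedSpace ℂ E]

/-! ## §1. The entry formula of a transported lift -/

section Entry

variable [Fintype X] [DecidableEq X]

/-- **THE TRANSPORTED LIFT ON A ONE-SITE FIELD**: `(M♯_T (δ_x ⊗ e))(y) = M(y,x) • R(T(y,x)) e` — the `x`-column of NODE 00's operator
constructor (`Node00.trLiftY_apply`; the sum over sites collapses at the single supported site, `R(V)0 = 0`).
[cite: Balaban1985BackgroundPropagators, (3.3) p.390, (3.12)–(3.14) p.393] -/
theorem trLiftY_single (M : Matrix Y X ℝ) (T : Y → X → 𝔸ˣ) (x : X) (e : 𝔸) (y : Y) :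
    trLiftY M T (Pi.single x e) y = ((M y x : ℝ) : ℂ) • R (T y x) e := by
  rw [trLiftY_apply, Finset.sum_eq_single x]
  · rw [Pi.single_eq_same]
  · intro x' _ hx'
    rw [Pi.single_eq_of_ne hx', R_zero, smul_zero]
  · intro h
    exact absurd (Finset.mem_univ x) h

/-- **A COORDINATE OF THE TRANSPORTED LIFT ON A ONE-SITE FIELD**: for a continuous linear `φ : 𝔸 → ℂ`,
`φ((M♯_T (δ_x ⊗ e))(y)) = M(y,x)·φ(R(T(y,x)) e)`.  For `𝔸 = M_N(ℂ)`, `φ` the `(a,b)` entry and `e` the matrix unit `E_{cd}` this is the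
`((y,a,b),(x,c,d))` matrix entry of the operator in the basis site ⊗ matrix unit — `M(y,x)·T(y,x)_{ac}·(T(y,x)⁻¹)_{db}`.
[cite: Balaban1985BackgroundPropagators, (3.3) p.390, (3.50) p.400] -/
theorem coord_trLiftY_single (φ : 𝔸 →L[ℂ] ℂ) (M : Matrix Y X ℝ) (T : Y → X → 𝔸ˣ) (x : X) (e : 𝔸) (y : Y) :
    φ (trLiftY M T (Pi.single x e) y) = ((M y x : ℝ) : ℂ) * φ (R (T y x) e) := by
  rw [trLiftY_single, map_smul, smul_eq_mul]

end Entry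

/-! ## §2. Along a u-dependent unit-valued transporter family on a chart ball: holomorphy, bound, range -/

section Family

variable {κ : Type}
variable (M : Matrix Y X ℝ) (T : E → Y → X → 𝔸ˣ) (φ : κ → 𝔸 →L[ℂ] ℂ) (e : κ → 𝔸) {Rc Kf Kb : ℝ}

/-- **HOLOMORPHY OF A COORDINATE** along a transporter family whose values and inverses are holomorphic on the chart ball `‖u‖ < R`:
`u ↦ M(y,x)·φ_k(T(u)(y,x)·e_l·T(u)(y,x)⁻¹)` is holomorphic there ([folklore]: products in a normed algebra, a continuous linear functional,
a constant factor; print's «analytic function of A(b)» for the transported far argument of (3.50)).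
[cite: Balaban1985BackgroundPropagators, Thm 3.4 and (3.50) p.400] -/
theorem differentiableOn_coord_trLift
    (hTf : ∀ y x, DifferentiableOn ℂ (fun u => (T u y x : 𝔸)) (ball (0 : E) Rc))
    (hTb : ∀ y x, DifferentiableOn ℂ (fun u => (((T u y x)⁻¹ : 𝔸ˣ) : 𝔸)) (ball (0 : E) Rc)) (y : Y) (x : X) (k l : κ) :
    DifferentiableOn ℂ (fun u => ((M y x : ℝ) : ℂ) * φ k (R (T u y x) (e l))) (ball (0 : E) Rc) := by
  have h1 : DifferentiableOn ℂ (fun u => (T u y x : 𝔸) * e l * (((T u y x)⁻¹ : 𝔸ˣ) : 𝔸)) (ball (0 : E) Rc) :=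
    ((hTf y x).mul_const (e l)).mul (hTb y x)
  have h2 : DifferentiableOn ℂ (fun u => φ k ((T u y x : 𝔸) * e l * (((T u y x)⁻¹ : 𝔸ˣ) : 𝔸))) (ball (0 : E) Rc) :=
    (φ k).differentiable.comp_differentiableOn h1
  simpa only [R_def] using h2.const_mul (((M y x : ℝ) : ℂ))

omit [NormedSpace ℂ E] in
/-- **THE BOUND OF A COORDINATE** on the chart ball: `‖T(u)(y,x)‖ ≤ Kf`, `‖T(u)(y,x)⁻¹‖ ≤ Kb` there ⟹
`‖M(y,x)·φ_k(R(T(u)(y,x)) e_l)‖ ≤ |M(y,x)|·‖φ_k‖·(Kf·‖e_l‖·Kb)` ([folklore]: operator norm of `φ_k`, submultiplicativity).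
[cite: Balaban1985BackgroundPropagators, Thm 3.4 p.400, (3.108) p.416] -/
theorem norm_coord_trLift_le
    (hKf : ∀ u ∈ ball (0 : E) Rc, ∀ y x, ‖(T u y x : 𝔸)‖ ≤ Kf)
    (hKb : ∀ u ∈ ball (0 : E) Rc, ∀ y x, ‖(((T u y x)⁻¹ : 𝔸ˣ) : 𝔸)‖ ≤ Kb)
    {u : E} (hu : u ∈ ball (0 : E) Rc) (y : Y) (x : X) (k l : κ) :
    ‖((M y x : ℝ) : ℂ) * φ k (R (T u y x) (e l))‖ ≤ |M y x| * (‖φ k‖ * (Kf * ‖e l‖ * Kb)) := by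
  rw [norm_mul, Complex.norm_real, Real.norm_eq_abs]
  refine mul_le_mul_of_nonneg_left ?_ (abs_nonneg _)
  refine ((φ k).le_opNorm _).trans (mul_le_mul_of_nonneg_left ?_ (norm_nonneg _))
  have hf := hKf u hu y x
  have hb := hKb u hu y x
  have h0 : 0 ≤ Kf := (norm_nonneg _).trans hf
  rw [R_def]
  calc ‖(T u y x : 𝔸) * e l * (((T u y x)⁻¹ : 𝔸ˣ) : 𝔸)‖
      ≤ ‖(T u y x : 𝔸) * e l‖ * ‖(((T u y x)⁻¹ : 𝔸ˣ) : 𝔸)‖ := norm_mul_le _ _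
    _ ≤ Kf * ‖e l‖ * Kb :=
        mul_le_mul ((norm_mul_le _ _).trans (mul_le_mul_of_nonneg_right hf (norm_nonneg _))) hb (norm_nonneg _)
          (mul_nonneg h0 (norm_nonneg _))

omit [NormedAddCommGroup E] [NormedSpace ℂ E] in
/-- **THE RANGE OF A COORDINATE IS THE KERNEL's**: where the flat kernel vanishes so does every coordinate, at every `u` — the locality of
`D_U`, `D*_U`, `Q(U)`, … is that of their flat kernels, uniformly along the chart. [cite: Balaban1985BackgroundPropagators, (3.3) p.390, (3.12)–(3.14) p.393] -/
theorem coord_trLift_eq_zero_of_kernel {y : Y} {x : X} (h : M y x = 0) (u : E) (k l : κ) :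
    ((M y x : ℝ) : ℂ) * φ k (R (T u y x) (e l)) = 0 := by
  rw [h, Complex.ofReal_zero, zero_mul]

omit [NormedAddCommGroup E] [NormedSpace ℂ E] in
/-- **THE COORDINATE IS NODE 00's**: `M(y,x)·φ_k(R(T(u)(y,x)) e_l) = φ_k((trLiftY M (T u) (δ_x ⊗ e_l))(y))` — the scalar family of §3 is,
entry by entry, the coordinate of the transported lift at the configuration `T(u)` (§1). [cite: Balaban1985BackgroundPropagators, (3.3) p.390, (3.50) p.400] -/
theorem coord_trLift_eq_coord_trLiftY [Fintype X] [DecidableEq X] (u : E) (y : Y) (x : X) (k l : κ) :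
    ((M y x : ℝ) : ℂ) * φ k (R (T u y x) (e l)) = φ k (trLiftY M (T u) (Pi.single x (e l)) y) :=
  (coord_trLiftY_single (φ k) M (T u) x (e l) y).symm

end Family

/-! ## §3. ★ The packaging: `RawEntryLetters` for the coordinates of a transported lift (square case) -/

section Packaging

variable {ν : ℕ} {Nf : Fin ν → ℕ} [∀ i, NeZero (Nf i)]
variable {κ : Type}

/-- ★ **THE COORDINATES OF A TRANSPORTED LIFT ALONG A HOLOMORPHIC UNIT-VALUED TRANSPORTER FAMILY HAVE THE LETTERS** (square case
`X = Y`; index `X × κ`, locations `loc (x,k) := ℓ x`).  A flat kernel `M` of range `r₀` w.r.t. `ℓ` (`M(y,x) ≠ 0 ⇒ d₁(ℓ y, ℓ x) ≤ r₀`);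
a transporter family `T : E → X → X → 𝔸ˣ` with `u ↦ T(u)(y,x)`, `u ↦ T(u)(y,x)⁻¹` holomorphic on `‖u‖ < R` and bounded there by `Kf`, `Kb`;
coordinates `φ_k : 𝔸 →L[ℂ] ℂ` and probes `e_l ∈ 𝔸`; a majorant `a ≥ |M(y,x)|·‖φ_k‖·(Kf·‖e_l‖·Kb)` for all entries, `a ≥ 0`, `ρ ≥ 0`
⟹ `RawEntryLetters (u ↦ ((y,k),(x,l)) ↦ M(y,x)·φ_k(R(T(u)(y,x)) e_l)) loc R ρ (a·e^{ρ r₀})` — module 56A's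
`rawEntryLetters_of_range_family` with holomorphy, bound and support supplied by §2.  By `coord_trLift_eq_coord_trLiftY` the family IS the
coordinate family of `u ↦ trLiftY M (T u)`: for each of NODE 00's local letters (`gradY`, `divY`, `curlY`, `coCurlY`, `QY`, `QsY`, `QpY`,
`QpsY` of `Node00/OpsYDeltaA`, all `trLiftY`s) along a complex chart of the configurations, the junction's `hEL` ∕ `hAL` is this theorem + the
chart's two letter bounds. [cite: Balaban1985BackgroundPropagators, (3.3) p.390, (3.12)–(3.14) p.393, Thm 3.4 and (3.50) p.400, Thm 3.10 (3.108) p.416; Balaban1988RG2Cluster, (2.5) p.12, p.15] -/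
theorem rawEntryLetters_trLift (M : Matrix X X ℝ) (T : E → X → X → 𝔸ˣ) (φ : κ → 𝔸 →L[ℂ] ℂ) (e : κ → 𝔸) {Rc Kf Kb : ℝ}
    (hTf : ∀ y x, DifferentiableOn ℂ (fun u => (T u y x : 𝔸)) (ball (0 : E) Rc))
    (hTb : ∀ y x, DifferentiableOn ℂ (fun u => (((T u y x)⁻¹ : 𝔸ˣ) : 𝔸)) (ball (0 : E) Rc))
    (hKf : ∀ u ∈ ball (0 : E) Rc, ∀ y x, ‖(T u y x : 𝔸)‖ ≤ Kf)
    (hKb : ∀ u ∈ ball (0 : E) Rc, ∀ y x, ‖(((T u y x)⁻¹ : 𝔸ˣ) : 𝔸)‖ ≤ Kb)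
    (ℓ : X → UT Nf) {r₀ : ℝ} (hM : ∀ y x, M y x ≠ 0 → tdist1 Nf (ℓ y) (ℓ x) ≤ r₀)
    {a : ℝ} (ha₀ : 0 ≤ a) (ha : ∀ y x k l, |M y x| * (‖φ k‖ * (Kf * ‖e l‖ * Kb)) ≤ a) {ρ : ℝ} (hρ : 0 ≤ ρ) :
    RawEntryLetters (fun u (i j : X × κ) => ((M i.1 j.1 : ℝ) : ℂ) * φ i.2 (R (T u i.1 j.1) (e j.2)))
      (fun i => ℓ i.1) Rc ρ (a * Real.exp (ρ * r₀)) := by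
  refine rawEntryLetters_of_range_family (fun i j => ?_) hρ ha₀ (fun u _ i j hne => ?_) (fun u hu i j => ?_)
  · exact differentiableOn_coord_trLift M T φ e hTf hTb i.1 j.1 i.2 j.2
  · exact hM i.1 j.1 fun h0 => hne (coord_trLift_eq_zero_of_kernel M T φ e h0 u i.2 j.2)
  · exact (norm_coord_trLift_le M T φ e hKf hKb hu i.1 j.1 i.2 j.2).trans (ha i.1 j.1 i.2 j.2)

end Packaging

/-! ## §4. The datum supplied by chart letters: the group pencil, contour words -/

section Pencil

variable [CompleteSpace 𝔸]

/-- **THE INVERSE OF A PENCIL VALUE**: a unit `V` with `V = exp(a)·U₀`, `U₀` a unit, has `V⁻¹ = U₀⁻¹·exp(−a)` (`exp(a)·exp(−a) = 1` in a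
Banach algebra) — the holomorphic continuation of `U*` off the real configurations, NOT the adjoint of the complex background.
[cite: Balaban1985BackgroundPropagators, (3.5) p.391, Thm 3.4 p.400] -/
theorem units_inv_eq_of_eq_exp_mul {V U₀ : 𝔸ˣ} {a : 𝔸} (h : (V : 𝔸) = exp a * U₀) :
    ((V⁻¹ : 𝔸ˣ) : 𝔸) = ((U₀⁻¹ : 𝔸ˣ) : 𝔸) * exp (-a) := by
  letI : NormedAlgebra ℚ 𝔸 := NormedAlgebra.restrictScalars ℚ ℂ 𝔸
  apply Units.inv_eq_of_mul_eq_one_right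
  rw [h, mul_assoc, ← mul_assoc (U₀ : 𝔸), Units.mul_inv, one_mul, ← Ring.inverse_exp,
    Ring.mul_inverse_cancel _ (NormedSpace.isUnit_exp _)]

/-- **THE PENCIL BINDER IS INHABITED**: for every chart reading `L` and background `U₀` there IS a unit-valued family with values
`T(u)(y,x) = exp(L_{yx}u)·U₀(y,x)` (Mathlib's unit of the Banach exponential times the background unit).
[cite: Balaban1985BackgroundPropagators, p.390 («U = U′U₀, U′ = exp iηA»), Thm 3.4 p.400] -/
theorem exists_pencil (L : Y → X → E →L[ℂ] 𝔸) (U₀ : Y → X → 𝔸ˣ) :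
    ∃ T : E → Y → X → 𝔸ˣ, ∀ u y x, (T u y x : 𝔸) = exp (L y x u) * U₀ y x := by
  letI : NormedAlgebra ℚ 𝔸 := NormedAlgebra.restrictScalars ℚ ℂ 𝔸
  refine ⟨fun u y x => (NormedSpace.isUnit_exp (L y x u)).unit * U₀ y x, fun u y x => ?_⟩
  rw [Units.val_mul, IsUnit.unit_spec]

end Pencil

section PencilFamily

variable [CompleteSpace 𝔸]
variable (L : Y → X → E →L[ℂ] 𝔸) (U₀ : Y → X → 𝔸ˣ) (T : E → Y → X → 𝔸ˣ) {Rc Λ K₀ : ℝ}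

/-- The PENCIL TRANSPORTER `u ↦ T(u)(y,x) = exp(L_{yx}u)·U₀(y,x)` is holomorphic on every ball (w4's forward letter atom BY NAME).
[cite: Balaban1985BackgroundPropagators, p.390 («U = U′U₀»), Thm 3.4 and (3.50) p.400] -/
theorem differentiableOn_pencil (hT : ∀ u y x, (T u y x : 𝔸) = exp (L y x u) * U₀ y x) (y : Y) (x : X) :
    DifferentiableOn ℂ (fun u => (T u y x : 𝔸)) (ball (0 : E) Rc) :=
  (differentiable_exp_clm_mul_const (L y x) (U₀ y x : 𝔸)).differentiableOn.congr fun u _ => hT u y x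

/-- … and so is its inverse `u ↦ T(u)(y,x)⁻¹ = U₀(y,x)⁻¹·exp(−L_{yx}u)` (w4's backward letter atom + `units_inv_eq_of_eq_exp_mul`).
[cite: Balaban1985BackgroundPropagators, (3.5) p.391, Thm 3.4 p.400] -/
theorem differentiableOn_pencil_inv (hT : ∀ u y x, (T u y x : 𝔸) = exp (L y x u) * U₀ y x) (y : Y) (x : X) :
    DifferentiableOn ℂ (fun u => (((T u y x)⁻¹ : 𝔸ˣ) : 𝔸)) (ball (0 : E) Rc) :=
  (differentiable_const_mul_exp_neg_clm (L y x) (((U₀ y x)⁻¹ : 𝔸ˣ) : 𝔸)).differentiableOn.congr fun u _ =>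
    units_inv_eq_of_eq_exp_mul (hT u y x)

variable [NormOneClass 𝔸]

/-- The pencil transporter is bounded by `K₀·e^{ΛR}` on the ball `‖u‖ < R` once `‖L_{yx}‖ ≤ Λ`, `‖U₀(y,x)‖ ≤ K₀`.
[cite: Balaban1985BackgroundPropagators, p.390, Thm 3.4 p.400] -/
theorem norm_pencil_le (hT : ∀ u y x, (T u y x : 𝔸) = exp (L y x u) * U₀ y x) (hL : ∀ y x, ‖L y x‖ ≤ Λ)
    (hU : ∀ y x, ‖(U₀ y x : 𝔸)‖ ≤ K₀) (hRc : 0 ≤ Rc) :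
    ∀ u ∈ ball (0 : E) Rc, ∀ y x, ‖(T u y x : 𝔸)‖ ≤ K₀ * Real.exp (Λ * Rc) := by
  intro u hu y x
  rw [hT u y x]
  exact norm_exp_clm_mul_const_le (L y x) (U₀ y x : 𝔸) (hL y x) (hU y x) hRc hu

/-- … and so is its inverse once `‖U₀(y,x)⁻¹‖ ≤ K₀`. [cite: Balaban1985BackgroundPropagators, (3.5) p.391, Thm 3.4 p.400] -/
theorem norm_pencil_inv_le (hT : ∀ u y x, (T u y x : 𝔸) = exp (L y x u) * U₀ y x) (hL : ∀ y x, ‖L y x‖ ≤ Λ)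
    (hUi : ∀ y x, ‖(((U₀ y x)⁻¹ : 𝔸ˣ) : 𝔸)‖ ≤ K₀) (hRc : 0 ≤ Rc) :
    ∀ u ∈ ball (0 : E) Rc, ∀ y x, ‖(((T u y x)⁻¹ : 𝔸ˣ) : 𝔸)‖ ≤ K₀ * Real.exp (Λ * Rc) := by
  intro u hu y x
  rw [units_inv_eq_of_eq_exp_mul (hT u y x)]
  exact norm_const_mul_exp_neg_clm_le (L y x) (((U₀ y x)⁻¹ : 𝔸ˣ) : 𝔸) (hL y x) (hUi y x) hRc hu

end PencilFamily

section PencilLetters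

variable [CompleteSpace 𝔸] [NormOneClass 𝔸]
variable {ν : ℕ} {Nf : Fin ν → ℕ} [∀ i, NeZero (Nf i)]
variable {κ : Type}

/-- ★ **THE LETTERS ALONG THE GROUP PENCIL** (square case): a transporter family with values `T(u)(y,x) = exp(L_{yx}u)·U₀(y,x)`,
`‖L_{yx}‖ ≤ Λ`, `‖U₀(y,x)^{±1}‖ ≤ K₀`, a kernel of range `r₀` w.r.t. `ℓ`, a majorant `a ≥ |M(y,x)|·‖φ_k‖·(K₀e^{ΛR}·‖e_l‖·K₀e^{ΛR})`
⟹ `RawEntryLetters` of the coordinate family at `(R, ρ, a·e^{ρ r₀})`, every `R ≥ 0`, `ρ ≥ 0` — print's «U = U′U₀, U′ = exp iηA … analytic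
function of A(b)» for a transported-lift letter, in the junction's currency (`hT` is inhabited for every `L`, `U₀`: `exists_pencil`).
[cite: Balaban1985BackgroundPropagators, p.390, Thm 3.4 and (3.50) p.400, (3.108) p.416; Balaban1988RG2Cluster, p.15] -/
theorem rawEntryLetters_trLift_pencil (M : Matrix X X ℝ) (L : X → X → E →L[ℂ] 𝔸) (U₀ : X → X → 𝔸ˣ)
    (T : E → X → X → 𝔸ˣ) (hT : ∀ u y x, (T u y x : 𝔸) = exp (L y x u) * U₀ y x) {Rc Λ K₀ : ℝ} (hRc : 0 ≤ Rc)
    (hL : ∀ y x, ‖L y x‖ ≤ Λ) (hU : ∀ y x, ‖(U₀ y x : 𝔸)‖ ≤ K₀) (hUi : ∀ y x, ‖(((U₀ y x)⁻¹ : 𝔸ˣ) : 𝔸)‖ ≤ K₀)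
    (φ : κ → 𝔸 →L[ℂ] ℂ) (e : κ → 𝔸) (ℓ : X → UT Nf) {r₀ : ℝ} (hM : ∀ y x, M y x ≠ 0 → tdist1 Nf (ℓ y) (ℓ x) ≤ r₀)
    {a : ℝ} (ha₀ : 0 ≤ a)
    (ha : ∀ y x k l, |M y x| * (‖φ k‖ * (K₀ * Real.exp (Λ * Rc) * ‖e l‖ * (K₀ * Real.exp (Λ * Rc)))) ≤ a) {ρ : ℝ} (hρ : 0 ≤ ρ) :
    RawEntryLetters (fun u (i j : X × κ) => ((M i.1 j.1 : ℝ) : ℂ) * φ i.2 (R (T u i.1 j.1) (e j.2)))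
      (fun i => ℓ i.1) Rc ρ (a * Real.exp (ρ * r₀)) :=
  rawEntryLetters_trLift M T φ e (differentiableOn_pencil L U₀ T hT) (differentiableOn_pencil_inv L U₀ T hT)
    (norm_pencil_le L U₀ T hT hL hU hRc) (norm_pencil_inv_le L U₀ T hT hL hUi hRc) ℓ hM ha₀ ha hρ

end PencilLetters

section Words

variable {β : Type*} (g : β → E → 𝔸ˣ) (w : Y → X → List β) (T : E → Y → X → 𝔸ˣ) {Rc K : ℝ} {n : ℕ}

omit [NormedAlgebra ℂ 𝔸] [NormedAddCommGroup E] [NormedSpace ℂ E] in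
/-- **THE VALUE OF A CONTOUR WORD**: `T(u)(y,x) = Π_{b ∈ w(y,x)} g_b(u)` in `𝔸ˣ` has value the ordered product of the letters' values
(parallel transport along a finite contour, [B9] (3.3), [Balaban1985Averaging] (55)). [cite: Balaban1985BackgroundPropagators, (3.3) p.390, (3.40) p.397] -/
theorem val_wordChart (hT : ∀ u y x, T u y x = ((w y x).map fun b => g b u).prod) (u : E) (y : Y) (x : X) :
    (T u y x : 𝔸) = ((w y x).map fun b => (g b u : 𝔸)).prod := by
  rw [hT u y x]
  change Units.coeHom 𝔸 _ = _
  rw [map_list_prod, List.map_map]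
  rfl

omit [NormedAlgebra ℂ 𝔸] [NormedAddCommGroup E] [NormedSpace ℂ E] in
/-- **THE INVERSE OF A CONTOUR WORD** is the REVERSED word of the inverse letters (the contour traversed backwards, each bond against its
orientation, [B9] (3.5)). [cite: Balaban1985BackgroundPropagators, (3.5) p.391, (3.40) p.397] -/
theorem val_inv_wordChart (hT : ∀ u y x, T u y x = ((w y x).map fun b => g b u).prod) (u : E) (y : Y) (x : X) :
    (((T u y x)⁻¹ : 𝔸ˣ) : 𝔸) = ((w y x).reverse.map fun b => (((g b u)⁻¹ : 𝔸ˣ) : 𝔸)).prod := by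
  rw [hT u y x, List.prod_inv_reverse]
  change Units.coeHom 𝔸 _ = _
  simp only [map_list_prod, List.map_reverse, List.map_map]
  rfl

/-- Every letter's value holomorphic on the ball ⟹ every contour word's value holomorphic there (w4's word calculus BY NAME).
[cite: Balaban1985BackgroundPropagators, Thm 3.4 p.400] -/
theorem differentiableOn_word (hT : ∀ u y x, T u y x = ((w y x).map fun b => g b u).prod)
    (hg : ∀ b, DifferentiableOn ℂ (fun u => (g b u : 𝔸)) (ball (0 : E) Rc)) (y : Y) (x : X) :
    DifferentiableOn ℂ (fun u => (T u y x : 𝔸)) (ball (0 : E) Rc) :=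
  (differentiableOn_listProd_map (g := fun b u => (g b u : 𝔸)) hg (w y x)).congr fun u _ => val_wordChart g w T hT u y x

/-- Every letter's inverse holomorphic on the ball ⟹ every contour word's inverse holomorphic there. [cite: Balaban1985BackgroundPropagators, (3.5) p.391, Thm 3.4 p.400] -/
theorem differentiableOn_word_inv (hT : ∀ u y x, T u y x = ((w y x).map fun b => g b u).prod)
    (hgi : ∀ b, DifferentiableOn ℂ (fun u => (((g b u)⁻¹ : 𝔸ˣ) : 𝔸)) (ball (0 : E) Rc)) (y : Y) (x : X) :
    DifferentiableOn ℂ (fun u => (((T u y x)⁻¹ : 𝔸ˣ) : 𝔸)) (ball (0 : E) Rc) :=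
  (differentiableOn_listProd_map (g := fun b u => (((g b u)⁻¹ : 𝔸ˣ) : 𝔸)) hgi (w y x).reverse).congr fun u _ =>
    val_inv_wordChart g w T hT u y x

omit [NormedAlgebra ℂ 𝔸] [NormedAddCommGroup E] [NormedSpace ℂ E] in
/-- A constant letter bound `K ≥ 1` on words of length `≤ n` gives the word bound `Kⁿ` (plumbing). [folklore] -/
private theorem listProd_map_const_le [NormOneClass 𝔸] {a : β → 𝔸} (hK : ∀ b, ‖a b‖ ≤ K) (hK1 : 1 ≤ K) {l : List β}
    (hl : l.length ≤ n) : ‖(l.map a).prod‖ ≤ K ^ n := by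
  refine (norm_listProd_map_le hK l).trans ?_
  rw [List.map_const', List.prod_replicate]
  exact pow_le_pow_right₀ hK1 hl

omit [NormedAlgebra ℂ 𝔸] [NormedSpace ℂ E] in
/-- Letters bounded by `K ≥ 1` on the ball, words of length `≤ n` ⟹ every contour word's value is bounded by `Kⁿ` there.
[cite: Balaban1985BackgroundPropagators, (3.40) p.397, Thm 3.4 p.400] -/
theorem norm_word_le [NormOneClass 𝔸] (hT : ∀ u y x, T u y x = ((w y x).map fun b => g b u).prod)
    (hK : ∀ b, ∀ u ∈ ball (0 : E) Rc, ‖(g b u : 𝔸)‖ ≤ K) (hK1 : 1 ≤ K) (hn : ∀ y x, (w y x).length ≤ n) :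
    ∀ u ∈ ball (0 : E) Rc, ∀ y x, ‖(T u y x : 𝔸)‖ ≤ K ^ n := by
  intro u hu y x
  rw [val_wordChart g w T hT u y x]
  exact listProd_map_const_le (fun b => hK b u hu) hK1 (hn y x)

omit [NormedAlgebra ℂ 𝔸] [NormedSpace ℂ E] in
/-- … and so is every contour word's inverse, once the inverse letters are bounded by `K` too.
[cite: Balaban1985BackgroundPropagators, (3.5) p.391, (3.40) p.397, Thm 3.4 p.400] -/
theorem norm_word_inv_le [NormOneClass 𝔸] (hT : ∀ u y x, T u y x = ((w y x).map fun b => g b u).prod)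
    (hKi : ∀ b, ∀ u ∈ ball (0 : E) Rc, ‖(((g b u)⁻¹ : 𝔸ˣ) : 𝔸)‖ ≤ K) (hK1 : 1 ≤ K) (hn : ∀ y x, (w y x).length ≤ n) :
    ∀ u ∈ ball (0 : E) Rc, ∀ y x, ‖(((T u y x)⁻¹ : 𝔸ˣ) : 𝔸)‖ ≤ K ^ n := by
  intro u hu y x
  rw [val_inv_wordChart g w T hT u y x]
  exact listProd_map_const_le (fun b => hKi b u hu) hK1 ((w y x).length_reverse.le.trans (hn y x))

end Words

section WordLetters

variable [NormOneClass 𝔸]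
variable {ν : ℕ} {Nf : Fin ν → ℕ} [∀ i, NeZero (Nf i)]
variable {κ : Type} {β : Type*}

/-- ★ **THE LETTERS ALONG CONTOUR-WORD TRANSPORTERS** (square case; the shape of NODE 00's taxicab ∕ plaquette-edge transporters
along a chart): unit-valued letters `g_b` with `g_b`, `g_b⁻¹` holomorphic and bounded by `K ≥ 1` on `‖u‖ < R`, transporters
`T(u)(y,x) = Π_{b∈w(y,x)} g_b(u)` with words of length `≤ n`, a kernel of range `r₀` w.r.t. `ℓ`, a majorant
`a ≥ |M(y,x)|·‖φ_k‖·(Kⁿ·‖e_l‖·Kⁿ)` ⟹ `RawEntryLetters` of the coordinate family at `(R, ρ, a·e^{ρ r₀})`.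
[cite: Balaban1985BackgroundPropagators, (3.3) p.390, (3.40) p.397, Thm 3.4 and (3.50) p.400, (3.108) p.416; Balaban1988RG2Cluster, p.15] -/
theorem rawEntryLetters_trLift_word (M : Matrix X X ℝ) (g : β → E → 𝔸ˣ) (w : X → X → List β)
    (T : E → X → X → 𝔸ˣ) (hT : ∀ u y x, T u y x = ((w y x).map fun b => g b u).prod) {Rc K : ℝ} {n : ℕ}
    (hg : ∀ b, DifferentiableOn ℂ (fun u => (g b u : 𝔸)) (ball (0 : E) Rc))
    (hgi : ∀ b, DifferentiableOn ℂ (fun u => (((g b u)⁻¹ : 𝔸ˣ) : 𝔸)) (ball (0 : E) Rc))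
    (hK : ∀ b, ∀ u ∈ ball (0 : E) Rc, ‖(g b u : 𝔸)‖ ≤ K) (hKi : ∀ b, ∀ u ∈ ball (0 : E) Rc, ‖(((g b u)⁻¹ : 𝔸ˣ) : 𝔸)‖ ≤ K)
    (hK1 : 1 ≤ K) (hn : ∀ y x, (w y x).length ≤ n) (φ : κ → 𝔸 →L[ℂ] ℂ) (e : κ → 𝔸) (ℓ : X → UT Nf) {r₀ : ℝ}
    (hM : ∀ y x, M y x ≠ 0 → tdist1 Nf (ℓ y) (ℓ x) ≤ r₀) {a : ℝ} (ha₀ : 0 ≤ a)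
    (ha : ∀ y x k l, |M y x| * (‖φ k‖ * (K ^ n * ‖e l‖ * K ^ n)) ≤ a) {ρ : ℝ} (hρ : 0 ≤ ρ) :
    RawEntryLetters (fun u (i j : X × κ) => ((M i.1 j.1 : ℝ) : ℂ) * φ i.2 (R (T u i.1 j.1) (e j.2)))
      (fun i => ℓ i.1) Rc ρ (a * Real.exp (ρ * r₀)) :=
  rawEntryLetters_trLift M T φ e (differentiableOn_word g w T hT hg) (differentiableOn_word_inv g w T hT hgi)
    (norm_word_le g w T hT hK hK1 hn) (norm_word_inv_le g w T hT hKi hK1 hn) ℓ hM ha₀ ha hρ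

end WordLetters

/-! ## §5. The real point `u = 0` of the pencil -/

section RealPoint

variable {κ : Type}

/-- **AT `u = 0` THE PENCIL IS THE BACKGROUND**: `T(0)(y,x) = U₀(y,x)` (`exp 0 = 1`), for any family with the pencil's values along a
reading `L` vanishing at `0` (e.g. continuous linear). [cite: Balaban1985BackgroundPropagators, p.390 («U = U′U₀»), Thm 3.4 p.400] -/
theorem pencil_zero (L : Y → X → E →L[ℂ] 𝔸) (U₀ : Y → X → 𝔸ˣ) (T : E → Y → X → 𝔸ˣ)
    (hT : ∀ u y x, (T u y x : 𝔸) = exp (L y x u) * U₀ y x) (y : Y) (x : X) : T 0 y x = U₀ y x := by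
  ext
  rw [hT, map_zero, NormedSpace.exp_zero, one_mul]

/-- **THE REAL-POINT IDENTITY, ALGEBRAIC HALF**: at `u = 0` the coordinate family along the pencil is the coordinate of NODE 00's letter AT
THE BACKGROUND `U₀`: `M(y,x)·φ_k(R(T(0)(y,x)) e_l) = φ_k((trLiftY M U₀ (δ_x ⊗ e_l))(y))`.  (Identifying `U₀` with the record's real
background, and the right side with the matrix of the real operator of record, is the consumer's reading.)
[cite: Balaban1985BackgroundPropagators, p.390, p.395 («It coincides with Δ_a in (2.19) if U = 1»), Thm 3.4 p.400; Balaban1988RG2Cluster, p.15 («For the pair (U,0) the operators are symmetric»)] -/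
theorem coord_trLift_pencil_zero [Fintype X] [DecidableEq X] (M : Matrix Y X ℝ) (L : Y → X → E →L[ℂ] 𝔸)
    (U₀ : Y → X → 𝔸ˣ) (T : E → Y → X → 𝔸ˣ) (hT : ∀ u y x, (T u y x : 𝔸) = exp (L y x u) * U₀ y x)
    (φ : κ → 𝔸 →L[ℂ] ℂ) (e : κ → 𝔸) (y : Y) (x : X) (k l : κ) :
    ((M y x : ℝ) : ℂ) * φ k (R (T 0 y x) (e l)) = φ k (trLiftY M U₀ (Pi.single x (e l)) y) := by
  rw [pencil_zero L U₀ T hT, coord_trLiftY_single]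

end RealPoint

end Literature.MathematicalPhysics.QuantumFieldTheory.Balaban1983to89.B13TransportedLiftLetters

end
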